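import Literature.NumberTheory.EllipticCurves.ThreeTorsionDescentHom
import HarnessLib

/-!
# The `3`-descent values `y − (mx + s)` on `y² = x³ + (mx + s)²` have cube valuations at every `v`
# with `v(2s) = 1`, `v(2m) ≤ 1` (Cohen–Pazuki, *Elementary 3-descent with a 3-isogeny*, Thm. 2.1 / §2, `D = 1`)

Topic `NumberTheory/EllipticCurves`. Sequel of `ThreeTorsionDescentHom` (the `3`-descent map
`α : (x, y) ↦ y − (mx + s)` of [CohenPazuki2009], Definition 1.3, case `D = 1`, on
`threeTorsionModel m s`) and general-`m` companion of the tree's `MordellCurveCubicDescentValuation`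
(the case `m = 0`: `(Y + B)(Y − B) = X³` with `2B` a `v`-unit). Everything here is proved.

Source [CohenPazuki2009] (held: `paper:arxiv-0903.4963`), §2: with the model of Lemma 1.2
(`y² = x³ + D(ax + b)²`, `a, b ∈ ℤ`) the image of `α` lies in the finite group of classes
«`u ∈ K*/K*³` … such that `u ℤ_K = 𝔮³ 𝔞` for an ideal `𝔞` dividing `2b`…» — i.e. **`3 ∣ ord_𝔭(α(P))`
for every prime `𝔭 ∤ 2b`** (Theorem 2.1 (2)–(3) of the paper, which then refines the primes dividing
`2b`; only this unramified part is formalized here, for `D = 1` and an arbitrary valued field).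

## What is formalized

* `Valuation.three_dvd_log_of_mul_add_eq_cube` — the local computation, for ANY `ℤᵐ⁰`-valued
  valuation `v` of a field: if `a (a + c x + d) = x³` with `a ≠ 0`, `v c ≤ 1`, `v d = 1`, then
  `3 ∣ log v(a)`. (If `v x > 1` then `v a > v x` and `v(a)² = v(x)³`; if `v x ≤ 1` then `a` and
  `a + cx + d` are integral with product `x³`, and they are not both non-units since then
  `v(cx) = 1 = v x` contradicts `v(x)³ < 1`.) The case `c = 0` is the tree's
  `Valuation.three_dvd_log_of_mul_eq_cube`.
* `Valuation.three_dvd_log_threeTorsionDescent` — for `W = threeTorsionModel m s` and every `v`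
  with `v(2s) = 1`, `v(2m) ≤ 1`: **`3 ∣ log v(α(P))` for every `P ∈ W(F)`**
  (`α(P)(α(P) + 2m x + 2s) = x³`; at `O` and `T` the values `1`, `(2s)²` are units). In the
  coordinates `y² + a₁xy + a₃y = x³` (`a₁ = 2m`, `a₃ = 2s`, `α = y`) this reads: the descent
  classes are unramified at every prime not dividing `a₃`.

## References

* [CohenPazuki2009] H. Cohen, F. Pazuki, *Elementary 3-descent with a 3-isogeny*, Acta Arith. 140
  (2009) 369–404: Definition 1.3, Theorem 2.1, §2.
* [SilvermanAEC2009] J. H. Silverman, *The Arithmetic of Elliptic Curves*, 2nd ed., Thm. X.1.1(c),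
  Prop. X.4.9 (the image of a descent map is unramified outside the bad primes).
* Template in the tree: `MordellCurveCubicDescentValuation`.
-/

noncomputable section

open scoped Classical WithZero

namespace Valuation

variable {L : Type*} [Field L] (v : Valuation L ℤᵐ⁰)

/-- **`a (a + cx + d) = x³`, `v c ≤ 1`, `v d = 1` ⟹ `3 ∣ ord_v(a)`** (`a ≠ 0`), for any
`ℤᵐ⁰`-valued valuation: the local computation behind «`u ℤ_K = 𝔮³𝔞` with `𝔞 ∣ 2b`» for the
`3`-descent values `u = α(P)`. [cite: CohenPazuki2009, Theorem 2.1 (2)] -/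
theorem three_dvd_log_of_mul_add_eq_cube {a c d x : L} (ha : a ≠ 0) (hc : v c ≤ 1) (hd : v d = 1)
    (h : a * (a + c * x + d) = x ^ 3) : (3 : ℤ) ∣ WithZero.log (v a) := by
  have hva : v a ≠ 0 := (v.ne_zero_iff).mpr ha
  set b := a + c * x + d with hb
  -- `b = 0` forces `x = 0`, `a = -d`, a unit
  by_cases hb0 : b = 0
  · have hx : x = 0 := by
      have : x ^ 3 = 0 := by rw [← h, hb0, mul_zero]
      exact pow_eq_zero_iff three_ne_zero |>.mp this
    have had : a = -d := by
      have e : a + c * x + d = 0 := hb0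
      rw [hx, mul_zero, add_zero] at e
      linear_combination e
    rw [had, map_neg, hd, WithZero.log_one]
    exact dvd_zero 3
  have hvb : v b ≠ 0 := (v.ne_zero_iff).mpr hb0
  have hx : x ≠ 0 := by
    rintro rfl
    rw [zero_pow three_ne_zero, mul_eq_zero] at h
    exact h.elim ha hb0
  have hvx : v x ≠ 0 := (v.ne_zero_iff).mpr hx
  have hcx : v (c * x) ≤ v x := by
    rw [map_mul]; exact mul_le_of_le_one_left zero_le hc
  -- logarithms: `α + β = 3ξ`
  have hprod : v a * v b = v x ^ 3 := by rw [← map_mul, h, map_pow]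
  have hlog : WithZero.log (v a) + WithZero.log (v b) = 3 * WithZero.log (v x) := by
    have e := congrArg WithZero.log hprod
    rwa [WithZero.log_mul hva hvb, WithZero.log_pow, nsmul_eq_mul, Nat.cast_ofNat] at e
  have h1 : (1 : ℤᵐ⁰) ≠ 0 := one_ne_zero
  by_cases hx1 : v x ≤ 1
  · /- `x` integral: `a`, `b` integral with product `x³` -/
    have hξ : WithZero.log (v x) ≤ 0 := by
      rw [← WithZero.log_one]; exact (WithZero.log_le_log hvx h1).mpr hx1
    have hcxd : v (c * x + d) ≤ 1 :=
      (v.map_add_le_max' _ _).trans (max_le (hcx.trans hx1) hd.le)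
    have ha1 : v a ≤ 1 := by
      by_contra hlt
      push Not at hlt
      have hvb_eq : v b = v a := by
        rw [hb, add_assoc]
        exact v.map_add_eq_of_lt_left (hcxd.trans_lt hlt)
      have hα : 0 < WithZero.log (v a) := by
        rw [← WithZero.log_one]; exact (WithZero.log_lt_log h1 hva).mpr hlt
      rw [hvb_eq] at hlog
      omega
    have hα : WithZero.log (v a) ≤ 0 := by
      rw [← WithZero.log_one]; exact (WithZero.log_le_log hva h1).mpr ha1
    have hb1 : v b ≤ 1 := (v.map_add_le_max' _ _).trans (max_le
      ((v.map_add_le_max' _ _).trans (max_le ha1 (hcx.trans hx1))) hd.le)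
    have hβ : WithZero.log (v b) ≤ 0 := by
      rw [← WithZero.log_one]; exact (WithZero.log_le_log hvb h1).mpr hb1
    rcases hα.lt_or_eq with hα_lt | hα_eq
    · rcases hβ.lt_or_eq with hβ_lt | hβ_eq
      · -- both non-units: `v(cx + d) < 1`, so `v(cx) = 1`, so `v x = 1`: contradiction
        exfalso
        have ha_lt : v a < 1 := by
          rw [← WithZero.log_one] at hα_lt; exact (WithZero.log_lt_log hva h1).mp hα_lt
        have hb_lt : v b < 1 := by
          rw [← WithZero.log_one] at hβ_lt; exact (WithZero.log_lt_log hvb h1).mp hβ_lt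
        have hcxd_lt : v (c * x + d) < 1 := by
          have e : c * x + d = b + -a := by rw [hb]; ring
          rw [e]
          exact (v.map_add_le_max' _ _).trans_lt (max_lt hb_lt (show v (-a) < 1 by rw [Valuation.map_neg]; exact ha_lt))
        have hcx1 : v (c * x) = 1 := by
          have e : c * x = -d + (c * x + d) := by ring
          have hlt' : v (c * x + d) < v (-d) := by rw [Valuation.map_neg, hd]; exact hcxd_lt
          rw [e, v.map_add_eq_of_lt_left hlt', Valuation.map_neg, hd]
        have hvx1 : v x = 1 := le_antisymm hx1 (by
          calc (1 : ℤᵐ⁰) = v (c * x) := hcx1.symm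
            _ ≤ v x := hcx)
        rw [hvx1, WithZero.log_one, mul_zero] at hlog
        omega
      · -- `b` a unit: `α = 3ξ`
        exact ⟨WithZero.log (v x), by omega⟩
    · rw [hα_eq]; exact dvd_zero 3
  · /- `x` not integral: then `v x < v a`, `v b = v a`, `2α = 3ξ` -/
    push Not at hx1
    have hξ : 0 < WithZero.log (v x) := by
      rw [← WithZero.log_one]; exact (WithZero.log_lt_log h1 hvx).mpr hx1
    have hd' : v d < v x := by rw [hd]; exact hx1
    have hax : v x < v a := by
      by_contra hle
      push Not at hle
      have hb_le : v b ≤ v x :=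
        (v.map_add_le_max' _ _).trans (max_le ((v.map_add_le_max' _ _).trans (max_le hle hcx)) hd'.le)
      have hα : WithZero.log (v a) ≤ WithZero.log (v x) := (WithZero.log_le_log hva hvx).mpr hle
      have hβ : WithZero.log (v b) ≤ WithZero.log (v x) := (WithZero.log_le_log hvb hvx).mpr hb_le
      omega
    have hrest : v (c * x + d) < v a :=
      (v.map_add_le_max' _ _).trans_lt (max_lt (hcx.trans_lt hax) (hd'.trans hax))
    have hvb_eq : v b = v a := by
      rw [hb, add_assoc]
      exact v.map_add_eq_of_lt_left hrest
    rw [hvb_eq] at hlog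
    exact ⟨WithZero.log (v a) - WithZero.log (v x), by omega⟩

open Literature.NumberTheory.EllipticCurves Literature.NumberTheory.EllipticCurves.ThreeTorsionDescent
  WeierstrassCurve in
/-- **`3 ∣ ord_v(α(P))` for every point `P` of `W = threeTorsionModel m s : y² = x³ + (mx + s)²`
whenever `v(2s) = 1` and `v(2m) ≤ 1`**, `α` the `3`-descent map `ThreeTorsionDescent.descent`
(`(x, y) ↦ y − (mx + s)`, `O ↦ 1`, `T ↦ (2s)²`): off `T`, `α (α + 2m·x + 2s) = x³`
(`three_dvd_log_of_mul_add_eq_cube`); at `O`, `T` the values `1`, `(2s)²` are `v`-units. In the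
coordinates `y² + a₁xy + a₃y = x³` (`a₁ = 2m`, `a₃ = 2s`): the descent classes are unramified at
every prime not dividing `a₃`. [cite: CohenPazuki2009, Theorem 2.1 (2)] -/
theorem three_dvd_log_threeTorsionDescent {W : WeierstrassCurve L} {m s : L}
    (hW : W = threeTorsionModel m s) (hvs : v (2 * s) = 1) (hvm : v (2 * m) ≤ 1)
    (P : W.toAffine.Point) : (3 : ℤ) ∣ WithZero.log (v (descent W m s P)) := by
  rcases P with _ | ⟨x, y, hP⟩
  · rw [← Affine.Point.zero_def, descent_zero, map_one, WithZero.log_one]; exact dvd_zero 3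
  · rw [descent_some]
    split_ifs with hy
    · rw [map_pow, hvs, one_pow, WithZero.log_one]; exact dvd_zero 3
    · refine v.three_dvd_log_of_mul_add_eq_cube (c := 2 * m) (d := 2 * s) (x := x) hy hvm hvs ?_
      have := mul_conj_eq_cube hW hP.1
      linear_combination this

end Valuation
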